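import Summits.AnomalousDissipation.AnomalousDissipation.Theorems.EnsembleRigidityGPTameDefectFloorParityForm3ToolsA
import Summits.AnomalousDissipation.AnomalousDissipation.Theorems.EnsembleRigidityGPTameDefectFloorParityForm3ToolsB
import Literature.Analysis.FluidPDE.EnergySpaceTorusProofs
import HarnessLib

/-!
# Stub `stub_gpParityForm3` of line `Sketch` (crux stmt-AnomalousDissipation-17938, `EnsembleRigidity.GPTameDefectFloor`) — the `7/100` enstrophy certificate of `f_GP` (ratio weights from a potential table)

For the Galloway–Proctor force `f_GP = (sin 2πx₂, sin 2πx₀, sin 2πx₁)` on `T³` and every `v` in the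
energy space `H` (`L²`, weakly divergence free, mean zero) with finite enstrophy
`‖∇v‖² = Torus.eGradNormSq v < ∞` we prove

  `∫ (v ⊗ v) : ∇f_GP = Torus.inertialPairing v f_GP ≥ -(7/100) ‖∇v‖²`,

improving the constants `√2/(4π) ≈ 0.1125` (`…ParityForm.lean`) and `1/12` (`…ParityForm2.lean`);
with `stub_linearFloor` this certifies the tame defect floor for all mean enstrophies
`G₁ < (3/2)/(7/100) = 150/7 ≈ 21.4`. (The optimum over potential tables of the kind used is
`≈ 0.0694`, the ceiling of all termwise schemes `0.0618`, the sharp energy-stability constant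
`0.0583`.)

Proof. On the Fourier side `I(u) = 2π Σⱼ Σₖ Re(conj ûⱼ(k - eⱼ) ûⱼ₊₁(k))` (one-shift Parseval).
The terms through a vanishing coefficient (`û(0) = 0`; `ûᵢ(±eᵢ) = 0` from `k · û(k) = 0`,
`Torus.IsWeaklyDivFree.sum_mul_mFourierCoeff_eq_zero`) are dropped, every other term is bounded by
AM–GM with the ratio weights `Φ(b)/Φ(a)`, `Φ(a)/Φ(b)` of an explicit integer potential `Φ` on the
coefficient slots (`…ParityForm3ToolsA.lean`: the `≈ 1400` slot budgets
`Φ(A) + Φ(B) ≤ (4π · 7/100) |p|² Φ(s)` are one kernel `decide` over the box `[-4, 4]³` plus a uniform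
tail), and the charges are summed against the enstrophy after symmetrising `p ↔ -p` and using the
in-plane tie on the shell `|p|² = 2` (`…ParityForm3ToolsB.lean`, the analytic layer for abstract
slot weights, constant `K`; here `K = 7π/25`, `K/(4π) = 7/100`).
References: FMRT 2001, Ch. IV (the form `b`); Constantin–Foias 1988, Ch. 4 (4.33);
Grafakos 2014, Prop. 3.2.7 (3) (Parseval on `Tⁿ`).
-/

-- `Summit.<Summit>.<Problem>` is the tree's mandated summit-side namespace (CONVENTIONS §2); single-conjunct summit, duplicate deliberate.
set_option linter.dupNamespace false

noncomputable section

namespace Summit.AnomalousDissipation.AnomalousDissipation.Theorems.EnsembleRigidity.GPTameDefectFloor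

open MeasureTheory Filter Topology UnitAddTorus
open scoped InnerProductSpace RealInnerProductSpace ENNReal NNReal
open Literature.Analysis.FunctionSpaces Literature.Analysis.FluidPDE
open Summit.AnomalousDissipation.AnomalousDissipation.Theorems.EnsembleRigidity

/-- Local notation: real vector fields on `T³`. -/
local notation "Vec3" => (UnitAddTorus (Fin 3)) → (EuclideanSpace ℝ (Fin 3))
/-- Local notation: `L²(T³; ℝ³)`. -/
local notation "L2" => (Lp (EuclideanSpace ℝ (Fin 3)) 2 (volume : Measure (UnitAddTorus (Fin 3))))
/-- Local notation: the energy space `H`. -/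
local notation "H3" => (Torus.energySpace (Fin 3))

/-- **The `7/100` bound on `L²` fields with vanishing zero mode and transversal coefficients**: for
`u ∈ L²(T³; ℝ³)` with `û(0) = 0`, `k · û(k) = 0` for all `k` and `‖∇u‖² < ∞`,
`∫ ⟪∇f_GP u, u⟫ ≥ -(7/100) ‖∇u‖²` — the analytic layer (`form3_pairing_ge_enstrophy`, constant
`K = 7π/25`, `K/(4π) = 7/100`) fed with the slot weights of `stub_gpParityForm3ToolsA`. [folklore] -/
theorem form3_pairing_ge_enstrophy_gp {u : Vec3} (hu : MemLp u 2 volume)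
    (hU0 : mFourierCoeff (EuclideanSpace.complexify ∘ u) 0 = 0)
    (hdiv : ∀ k : Fin 3 → ℤ,
      ∑ j, (k j : ℂ) * mFourierCoeff (EuclideanSpace.complexify ∘ u) k j = 0)
    (hfin : Torus.eGradNormSq u ≠ ⊤) :
    -(7 / 100 * (Torus.eGradNormSq u).toReal) ≤ ∫ x, ⟪Torus.fderiv gpForce x (u x), u x⟫_ℝ := by
  obtain ⟨α, β, hα, hβ, hαC, hβC, hedge, hW4, hW5⟩ := stub_gpParityForm3ToolsA
  have h := form3_pairing_ge_enstrophy α β (7 * Real.pi / 25) 1102 hα hβ hαC hβC hedge hW4 hW5 hu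
    hU0 hdiv hfin
  have e : 7 * Real.pi / 25 / (4 * Real.pi) = 7 / 100 := by
    field_simp
    ring
  rwa [e] at h

/-! ## The stub -/

/-- **Stub `stub_gpParityForm3`** (card `ground-state-jump`, L1‴) — RATIO WEIGHTS FROM A POTENTIAL
TABLE. For every `v` in the energy space `H` of `T³` with finite enstrophy,
`∫ (v ⊗ v) : ∇f_GP ≥ -(7/100) ‖∇v‖²`: the one-shift series of the parity bound with the terms
through vanishing coefficients dropped and every live edge `a → b` of the coefficient lattice
weighted by `Φ(b)/Φ(a) ↔ Φ(a)/Φ(b)` for an explicit integer potential `Φ` whose `≈ 1400` slot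
budgets are certified by kernel reduction. Certifies the tame defect floor up to mean enstrophy
`G₁ < 150/7`. [folklore] -/
theorem stub_gpParityForm3 : ∀ v : H3, Torus.eGradNormSq ((v : L2) : Vec3) ≠ ⊤ → -(7 / 100 * (Torus.eGradNormSq ((v : L2) : Vec3)).toReal) ≤ Torus.inertialPairing (v : L2) gpForce := by
  intro v hv
  rw [Torus.inertialPairing]
  have hmem := (Torus.mem_energySpace_iff_holds (v : L2)).1 v.2
  exact form3_pairing_ge_enstrophy_gp (Lp.memLp (v : L2))
    (Torus.mFourierCoeff_complexify_coe_zero_of_mem v.2)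
    (Torus.IsWeaklyDivFree.sum_mul_mFourierCoeff_eq_zero (Lp.memLp (v : L2)) hmem.1) hv

end Summit.AnomalousDissipation.AnomalousDissipation.Theorems.EnsembleRigidity.GPTameDefectFloor

end
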